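import Summits.QuantumFields.BalabanUV.InfraRed.StrongCouplingDoorCeilings
import HarnessLib

/-!
# Strong-coupling front: THE THREE OWNED WINDOWS IN ONE THEOREM and the filed SC-b instance `β_W = 0.266` —
observatory of the non-perturbative crossover; no mass-gap claim

IR-3 v2 TWO-FRONT CROSSOVER LEDGER, front SC (`β₀`), `SU(2)`, `d = 4`, Wilson normalisation `β_W = 4/g²` (tree coupling
`β = β_W/2`, 't Hooft coupling `β_W/4`).
ABSOLUTE RULE of this package: No internally-minted statement may enter as a cited fact. Every hypothesis is either
kernel-proved in this package or a verbatim quotation of a PUBLISHED theorem with page reference. The manuscript(s)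
under audit are NOT citable for their own disputed steps — they are the thing under adjudication; programme-internal
(2001/route/tribunal) claims are never citable.  Nothing is cited here: every statement below is a specialisation or a
conjunction of kernel theorems of this package (`[folklore]` labels are attributions, not citations).

## What this file is

Leaf (34) of the strong-coupling front (lineage `ir-sc`, gen 13): the hand-off object of the single-site Dobrushin line.
* `su2_strongCouplingFronts` — the three hypothesis-free ∀-doors of the package in ONE conjunction, each on its own
  half-open window: SC-a (infinite-volume DLR uniqueness + clustering, `DLRMassGapAt 4 2 (β_W/4)`) for `β_W < 2/9`
  (`StrongCouplingFluxCovariance.su2_dlrMassGapAt`, rows `18`), SC-b (volume-uniform torus clustering,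
  `CrossoverLedger.StrongCouplingFront (fundamentalLatticeRep 2) (β_W/2)`) for `β_W < 4/15`
  (`StrongCouplingQuarterModulusFourFifteenths.su2_strongCouplingFront_lt_fourFifteenths`, forest rows `15`), SC-c
  (infinite-volume transfer-operator gap, `CrossoverLedger.LatticeMassGap (fundamentalRep (Fin 2)) (β_W/2)
  (krRate (14·β_W·¼))`) for `β_W < 2/7` (`StrongCouplingQuarterModulusTwoSevenths.su2_latticeMassGap_axial_lt_twoSevenths`,
  axial rows `14`);
* `su2_strongCouplingFronts_ceilings` — the matching conjunction of the three floor-meets-ceiling equivalences of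
  `StrongCouplingDoorCeilings` (`D·β_W·K₂ < 1` with an admissible modulus `K₂` is solvable iff `β_W < 4/D`, `D = 18, 15, 14`):
  the windows above are exactly the reach of the method;
* `su2_strongCouplingFront_0266` — the SC-b instance at the filed Wilson coupling `β_W = 0.266 = 133/500`
  (`0.266 < 4/15 = 0.2666…`; `g² = 4/0.266 = 15.04`), in the shape of `StrongCouplingTwoNinthsInstances` — the crossover
  ledger carries FILED instances, not window suprema; the SC-c instance at `β_W = 0.285` is
  `StrongCouplingDoorCeilings.su2_latticeMassGap_axial_fiftySevenTwoHundredths`, the SC-a instance at `β_W = 0.222` is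
  `StrongCouplingTwoNinthsInstances.su2_dlrMassGapAt_0222`.

NOT CLAIMED: anything at `β_W ≥ 2/7` (SC-c), `≥ 4/15` (SC-b), `≥ 2/9` (SC-a), at weak coupling, uniformly in `β`, or
about a continuum limit; `krRate` is the Dobrushin rate of the method, not a physical mass; no mass-gap claim in the
sense of the summit; NOT Bałaban's renormalisation group.
-/

noncomputable section

open Literature.MathematicalPhysics.QuantumLattice (fundamentalRep fundamentalLatticeRep)
open Literature.MathematicalPhysics.QuantumFieldTheory.Balaban1983to89
open Literature.MathematicalPhysics.QuantumFieldTheory.Balaban1983to89.StrongCouplingDobrushinWindow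
  (DLRMassGapAt OneLinkKRModulusSU2)
open Literature.MathematicalPhysics.QuantumFieldTheory.Balaban1983to89.StrongCouplingTorusWindow (krRate)
open Summit.QuantumFields.BalabanUV.InfraRed.StrongCouplingFluxCovariance (su2_dlrMassGapAt)
open Summit.QuantumFields.BalabanUV.InfraRed.StrongCouplingQuarterModulusFourFifteenths
  (su2_strongCouplingFront_lt_fourFifteenths)
open Summit.QuantumFields.BalabanUV.InfraRed.StrongCouplingQuarterModulusTwoSevenths
  (su2_latticeMassGap_axial_lt_twoSevenths)
open Summit.QuantumFields.BalabanUV.InfraRed.StrongCouplingDoorCeilings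
  (su2_singleSiteDoor_iff su2_forestDoor_iff su2_axialDoor_iff)

namespace Summit.QuantumFields.BalabanUV.InfraRed.StrongCouplingFrontSummary

/-- **The strong-coupling front of the package, all three currencies, hypothesis-free**: at every Wilson `β_W ≥ 0`,
SC-a holds for `β_W < 2/9`, SC-b for `β_W < 4/15`, SC-c (axial rate) for `β_W < 2/7`. [folklore] -/
theorem su2_strongCouplingFronts {βW : ℝ} (h0 : 0 ≤ βW) :
    (βW < 2 / 9 → DLRMassGapAt 4 2 (βW / 4)) ∧
      (βW < 4 / 15 → CrossoverLedger.StrongCouplingFront (fundamentalLatticeRep 2) (βW / 2)) ∧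
        (βW < 2 / 7 →
          CrossoverLedger.LatticeMassGap (fundamentalRep (Fin 2)) (βW / 2) (krRate (14 * βW * (1 / 4)))) :=
  ⟨su2_dlrMassGapAt h0, su2_strongCouplingFront_lt_fourFifteenths h0, su2_latticeMassGap_axial_lt_twoSevenths h0⟩

/-- **The three windows are the exact reach of the single-site method**: with the one-link modulus floor `K₂ ≥ 1/4`
in and the quarter-modulus certificates up to `κ = 12/7` out, the smallness condition `D·β_W·K₂ < 1` of the door with
row count `D = 18` (single site, SC-a), `15` (staggered temporal forests, SC-b), `14` (temporal axial gauge, SC-c) is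
solvable by an admissible `K₂` iff `β_W < 2/9`, `4/15`, `2/7` respectively. [folklore] -/
theorem su2_strongCouplingFronts_ceilings {βW : ℝ} (h0 : 0 ≤ βW) :
    ((∃ K₂ : ℝ, 0 ≤ K₂ ∧ OneLinkKRModulusSU2 βW K₂ ∧ 18 * βW * K₂ < 1) ↔ βW < 2 / 9) ∧
      ((∃ K₂ : ℝ, 0 ≤ K₂ ∧ OneLinkKRModulusSU2 βW K₂ ∧ 15 * βW * K₂ < 1) ↔ βW < 4 / 15) ∧
        ((∃ K₂ : ℝ, 0 ≤ K₂ ∧ OneLinkKRModulusSU2 βW K₂ ∧ 14 * βW * K₂ < 1) ↔ βW < 2 / 7) :=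
  ⟨su2_singleSiteDoor_iff h0, su2_forestDoor_iff h0, su2_axialDoor_iff h0⟩

/-- **SC-b at the filed Wilson coupling `β₀W = 0.266 = 133/500`** (volume-uniform torus front at every tree coupling
`≤ 0.133`; `0.266 < 4/15`; `g² = 15.04`): the largest SC-b instance filed by this lineage. [folklore] -/
theorem su2_strongCouplingFront_0266 :
    CrossoverLedger.StrongCouplingFront (fundamentalLatticeRep 2) ((0.266 : ℝ) / 2) :=
  su2_strongCouplingFront_lt_fourFifteenths (by norm_num) (by norm_num)

/-- SC-b at `β₀W = 4/15.04…`: every bare coupling `g² > 15` lies inside the SC-b window — the instance at the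
integer `g² = 16`, i.e. `β_W = 1/4`, is `StrongCouplingQuarterModulusFourFifteenths.su2_strongCouplingFront_quarter`;
here the generic form: `15 < g²` and `β_W = 4/g²` give the front. [folklore] -/
theorem su2_strongCouplingFront_of_bareCoupling {gsq : ℝ} (hg : 15 < gsq) :
    CrossoverLedger.StrongCouplingFront (fundamentalLatticeRep 2) ((4 / gsq) / 2) := by
  have hg0 : 0 < gsq := lt_trans (by norm_num) hg
  exact su2_strongCouplingFront_lt_fourFifteenths (by positivity)
    (div_lt_div_of_pos_left (by norm_num) (by norm_num) hg)

end Summit.QuantumFields.BalabanUV.InfraRed.StrongCouplingFrontSummary
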